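import Summits.QuantumFields.YangMills.Theorems.LuscherReductionTwistedTraceScalingBOTransport
import HarnessLib

/-!
# COLOUR ASSEMBLY of the one-sided fibre transfer: `Z·∫_v K̃_β(U, oT u v)Ω(v̂)dπ(v) = ∫_c fpFibreTransfer β Ω W (c⁻¹Uc) u dc`
# (lane A of S-BASE, crux `TwistedTraceScaling` stmt-QuantumFields-20203, C4-CORE, the (OD) pen, step (C3) of `pub/ym-fleet/ym-luscher-20007-p1/COARSE-DESIGN.md` §27.5)

The (B-OD) door in `L²(w)` (`…BODefect`) needs the transfer `K̃(φ⊗Ω)(U) = ∫_{u} φ(u)·Φ(U,u) du` (`transferApply_boFun_eq`) with the fibre-transferred profile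
`Φ(U,u) = ∫_v K̃_β(U, orthoTube u v)·Ω(v̂) dπ(v)`.  Inserting the Faddeev–Popov form of the averaged kernel (`avgKernel_fp`: `Z·K̃_β(U,V) = ∫_c∫_g W(g)K_β(c⁻¹Uc, V^g) dg dc`) and
swapping the fibre integral with the colour integral gives the one-sided analogue of `…BTColourFP.boKernel_fp`:
* `measurable_fpColour_integrand` — `((v,c),g) ↦ W(g)·K_β(c⁻¹Uc, (orthoTube u v)^g)` is jointly measurable;
* ★★★ `fibreTransfer_fp` — `Z·Φ(U,u) = ∫_c fpFibreTransfer β Ω W (c⁻¹Uc) u dc` (and the integrand is integrable in `c`), for bounded measurable `Ω`, an FP weight `W` with orbit integral `Z`.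
With `…BOTransport.fpFibreTransfer_two_sided` each `fpFibreTransfer (c⁻¹(oT u' v')c) u = fpFibreTransfer (oT (Ad_{c⁻¹}u') (R_{c⁻¹}v')) u` is then transported to the central fibre.
HONEST FRAMING: Fubini bookkeeping for a stub of a child of the CONDITIONAL route R2b1; (B-OD), (B-ST) OPEN; C4-CORE OPEN; not infinite volume, not a gap, not Clay.
-/

set_option autoImplicit false

noncomputable section

open MeasureTheory Filter Topology Real
open scoped BigOperators
open Literature.MathematicalPhysics.QuantumFieldTheory
open Literature.MathematicalPhysics.QuantumLattice

namespace Summit.QuantumFields.YangMills.Theorems.FemtoTransferGap.TwoLattice.ConstTube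

open Summit.QuantumFields.YangMills.Theorems.FemtoTransferGap
open Summit.QuantumFields.YangMills.Theorems.FemtoTransferGap.TwoLattice
open Summit.QuantumFields.YangMills.Theorems.FemtoTransferGap.TwoLattice.Avg
open Summit.QuantumFields.YangMills.Theorems.FemtoTransferGap.TwoLattice.Stiff (LinkSpace)

variable {L : ℕ} [NeZero L]

/-- The three-variable integrand `((v,c),g) ↦ W(g)·K_β(c⁻¹Uc, (orthoTube u v)^g)` is jointly measurable. [folklore] -/
theorem measurable_fpColour_integrand (β : ℝ) {W : (Site 3 L → SU2) → ℝ} (hW : Measurable W) (U : GaugeConfig 3 L SU2) (u : GaugeConfig 3 1 SU2) :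
    Measurable fun q : ((Edge 3 L → Fin 3 → ℝ) × SU2) × (Site 3 L → SU2) =>
      W q.2 * transferKernel su2Rep β (gaugeTransform (fun _ : Site 3 L => q.1.2⁻¹) U) (gaugeTransform q.2 (orthoTube L u q.1.1)) := by
  haveI : SecondCountableTopology SU2 := secondCountableTopology_su2
  have hK : Measurable fun p : GaugeConfig 3 L SU2 × GaugeConfig 3 L SU2 => transferKernel su2Rep β p.1 p.2 :=
    (continuous_transferKernel su2Rep continuous_su2Rep β).measurable
  have h1 : Measurable fun q : ((Edge 3 L → Fin 3 → ℝ) × SU2) × (Site 3 L → SU2) => gaugeTransform (fun _ : Site 3 L => q.1.2⁻¹) U := by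
    have hc : Measurable fun _ : ((Edge 3 L → Fin 3 → ℝ) × SU2) × (Site 3 L → SU2) => U := measurable_const
    have ha : Measurable fun q : ((Edge 3 L → Fin 3 → ℝ) × SU2) × (Site 3 L → SU2) => (U, q.1.2⁻¹) := hc.prodMk (measurable_snd.comp measurable_fst).inv
    have h := (measurable_constGaugeAction (L := L)).comp ha
    simpa only [Function.comp_def] using h
  have h2 : Measurable fun q : ((Edge 3 L → Fin 3 → ℝ) × SU2) × (Site 3 L → SU2) => gaugeTransform q.2 (orthoTube L u q.1.1) := by
    have ha : Measurable fun q : ((Edge 3 L → Fin 3 → ℝ) × SU2) × (Site 3 L → SU2) => (orthoTube L u q.1.1, q.2) :=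
      ((measurable_orthoTube_right (L := L) u).comp (measurable_fst.comp measurable_fst)).prodMk measurable_snd
    have h := (measurable_gaugeAction (L := L)).comp ha
    simpa only [Function.comp_def] using h
  have h3 : Measurable fun q : ((Edge 3 L → Fin 3 → ℝ) × SU2) × (Site 3 L → SU2) =>
      transferKernel su2Rep β (gaugeTransform (fun _ : Site 3 L => q.1.2⁻¹) U) (gaugeTransform q.2 (orthoTube L u q.1.1)) := by
    have h := hK.comp (h1.prodMk h2); simpa only [Function.comp_def] using h
  exact (hW.comp measurable_snd).mul h3

/-- ★★★ **COLOUR ASSEMBLY OF THE ONE-SIDED FIBRE TRANSFER**: for bounded measurable `Ω` and an FP weight `W` (bounded measurable, orbit integral `∫_c W(c·g) dc = Z` for every `g`),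
`Z·∫_v K̃_β(U, orthoTube u v)·Ω(v̂) dπ(v) = ∫_c fpFibreTransfer β Ω W (c⁻¹Uc) u dc`, and the right integrand is integrable in `c`. [cite: Luscher1983, §3] [cite: SeilerLNP1982, §3] -/
theorem fibreTransfer_fp (β : ℝ) {Ω : LinkSpace L → ℝ} (hΩm : Measurable Ω) {CΩ : ℝ} (hCΩ : ∀ x, |Ω x| ≤ CΩ)
    {W : (Site 3 L → SU2) → ℝ} (hW : Measurable W) {CW : ℝ} (hCW : ∀ g, |W g| ≤ CW) {Z : ℝ}
    (hZ : ∀ g : Site 3 L → SU2, ∫ c, W (fun x => c * g x) ∂haarProbability SU2 = Z) (U : GaugeConfig 3 L SU2) (u : GaugeConfig 3 1 SU2) :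
    Integrable (fun c : SU2 => fpFibreTransfer L β Ω W (gaugeTransform (fun _ : Site 3 L => c⁻¹) U) u) (haarProbability SU2) ∧
      Z * ∫ v, avgKernel β U (orthoTube L u v) * Ω (linkEmbed L v) ∂orthoTransverse L =
        ∫ c, fpFibreTransfer L β Ω W (gaugeTransform (fun _ : Site 3 L => c⁻¹) U) u ∂haarProbability SU2 := by
  haveI := isFiniteMeasure_orthoTransverse L
  haveI : SecondCountableTopology SU2 := secondCountableTopology_su2
  obtain ⟨M, hM⟩ := exists_transferKernel_le su2Rep continuous_su2Rep β (L := L)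
  have hM0 : 0 ≤ M := (transferKernel_pos su2Rep β (1 : GaugeConfig 3 L SU2) 1).le.trans (hM 1 1)
  have hCΩ0 : 0 ≤ CΩ := (abs_nonneg _).trans (hCΩ 0)
  have hCW0 : 0 ≤ CW := (abs_nonneg _).trans (hCW 1)
  set P : ℝ := (orthoTransverse L).real Set.univ with hP
  -- the `g`-integral `G(v,c) = ∫ W(g) K(c⁻¹Uc, (oT u v)^g) dg`
  set G : (Edge 3 L → Fin 3 → ℝ) × SU2 → ℝ := fun t =>
    ∫ g, W g * transferKernel su2Rep β (gaugeTransform (fun _ : Site 3 L => t.2⁻¹) U) (gaugeTransform g (orthoTube L u t.1)) ∂gaugeMeasure L with hG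
  have h3 := measurable_fpColour_integrand (L := L) β hW U u
  have hGm : Measurable G := by
    have h := (h3.stronglyMeasurable.integral_prod_right' (ν := gaugeMeasure L)).measurable
    rw [hG]; simpa only using h
  have hGb : ∀ t, |G t| ≤ CW * M := fun t => by
    rw [hG]; dsimp only
    calc |∫ g, W g * transferKernel su2Rep β (gaugeTransform (fun _ : Site 3 L => t.2⁻¹) U) (gaugeTransform g (orthoTube L u t.1)) ∂gaugeMeasure L|
        ≤ ∫ g, |W g * transferKernel su2Rep β (gaugeTransform (fun _ : Site 3 L => t.2⁻¹) U) (gaugeTransform g (orthoTube L u t.1))| ∂gaugeMeasure L :=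
          abs_integral_le_integral_abs
      _ ≤ ∫ _g, CW * M ∂gaugeMeasure L :=
          integral_mono_of_nonneg (ae_of_all _ fun _ => abs_nonneg _) (integrable_const _) (ae_of_all _ fun g => by
            show |W g * _| ≤ CW * M
            rw [abs_mul, abs_of_pos (transferKernel_pos su2Rep β _ _)]
            exact mul_le_mul (hCW g) (hM _ _) (transferKernel_pos su2Rep β _ _).le hCW0)
      _ = CW * M := by simp
  -- Step 1: insert the FP form of the averaged kernel
  have hstep1 : Z * ∫ v, avgKernel β U (orthoTube L u v) * Ω (linkEmbed L v) ∂orthoTransverse L =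
      ∫ v, (∫ c, G (v, c) ∂haarProbability SU2) * Ω (linkEmbed L v) ∂orthoTransverse L := by
    rw [← integral_const_mul]
    refine integral_congr_ae (ae_of_all _ fun v => ?_)
    dsimp only
    rw [← mul_assoc, avgKernel_fp β hW hCW hZ]
  -- Step 2: swap `v ↔ c`
  have hFm : Measurable fun p : (Edge 3 L → Fin 3 → ℝ) × SU2 => G p * Ω (linkEmbed L p.1) := hGm.mul (hΩm.comp ((measurable_linkEmbed L).comp measurable_fst))
  have hFb : ∀ p : (Edge 3 L → Fin 3 → ℝ) × SU2, |G p * Ω (linkEmbed L p.1)| ≤ CW * M * CΩ := fun p => by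
    rw [abs_mul]; exact mul_le_mul (hGb _) (hCΩ _) (abs_nonneg _) (mul_nonneg hCW0 hM0)
  have hswap : ∫ v, (∫ c, G (v, c) ∂haarProbability SU2) * Ω (linkEmbed L v) ∂orthoTransverse L =
      ∫ c, ∫ v, G (v, c) * Ω (linkEmbed L v) ∂orthoTransverse L ∂haarProbability SU2 := by
    have hint : Integrable (fun p : (Edge 3 L → Fin 3 → ℝ) × SU2 => G p * Ω (linkEmbed L p.1)) ((orthoTransverse L).prod (haarProbability SU2)) :=
      integrable_of_measurable_abs_le _ hFm hFb
    have e : ∀ v, (∫ c, G (v, c) ∂haarProbability SU2) * Ω (linkEmbed L v) = ∫ c, G (v, c) * Ω (linkEmbed L v) ∂haarProbability SU2 := fun v => by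
      rw [← integral_mul_const]
    simp_rw [e]
    exact integral_integral_swap hint
  -- Step 3: for each `c`, the `v`-integral of `G(v,c)Ω(v̂)` is the product integral defining `fpFibreTransfer (c⁻¹Uc) u`
  have hfibre : ∀ c : SU2, ∫ v, G (v, c) * Ω (linkEmbed L v) ∂orthoTransverse L = fpFibreTransfer L β Ω W (gaugeTransform (fun _ : Site 3 L => c⁻¹) U) u := fun c => by
    obtain ⟨B, hB⟩ := abs_fpFibreTransfer_integrand_le (L := L) β hCΩ hCW (gaugeTransform (fun _ : Site 3 L => c⁻¹) U) u
    have hint : Integrable (fun p : (Edge 3 L → Fin 3 → ℝ) × (Site 3 L → SU2) =>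
        W p.2 * transferKernel su2Rep β (gaugeTransform (fun _ : Site 3 L => c⁻¹) U) (gaugeTransform p.2 (orthoTube L u p.1)) * Ω (linkEmbed L p.1))
        ((orthoTransverse L).prod (gaugeMeasure L)) :=
      integrable_of_measurable_abs_le _ (measurable_fpFibreTransfer_integrand β hΩm hW _ _) hB
    unfold fpFibreTransfer
    rw [integral_prod _ hint]
    refine integral_congr_ae (ae_of_all _ fun v => ?_)
    dsimp only
    rw [hG]; dsimp only
    rw [← integral_mul_const]
  simp_rw [hfibre] at hswap
  refine ⟨?_, by rw [hstep1, hswap]⟩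
  -- integrability in `c`: measurable (as a partial integral) and bounded
  have hIm : Measurable fun c : SU2 => ∫ v, G (v, c) * Ω (linkEmbed L v) ∂orthoTransverse L := by
    have hr : Measurable fun r : SU2 × (Edge 3 L → Fin 3 → ℝ) => G (r.2, r.1) * Ω (linkEmbed L r.2) := by
      have hp : Measurable fun r : SU2 × (Edge 3 L → Fin 3 → ℝ) => ((r.2, r.1) : (Edge 3 L → Fin 3 → ℝ) × SU2) := measurable_snd.prodMk measurable_fst
      have h := hFm.comp hp
      simpa only [Function.comp_def] using h
    have hI := (hr.stronglyMeasurable.integral_prod_right' (ν := orthoTransverse L)).measurable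
    simpa only using hI
  have hIm' : Measurable fun c : SU2 => fpFibreTransfer L β Ω W (gaugeTransform (fun _ : Site 3 L => c⁻¹) U) u := by
    have e : (fun c : SU2 => fpFibreTransfer L β Ω W (gaugeTransform (fun _ : Site 3 L => c⁻¹) U) u) = fun c : SU2 => ∫ v, G (v, c) * Ω (linkEmbed L v) ∂orthoTransverse L :=
      funext fun c => (hfibre c).symm
    rw [e]; exact hIm
  refine integrable_of_measurable_abs_le _ hIm' (C := CW * M * CΩ * P) fun c => ?_
  rw [← hfibre c]
  calc |∫ v, G (v, c) * Ω (linkEmbed L v) ∂orthoTransverse L| ≤ ∫ v, |G (v, c) * Ω (linkEmbed L v)| ∂orthoTransverse L := abs_integral_le_integral_abs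
    _ ≤ ∫ _v, CW * M * CΩ ∂orthoTransverse L :=
        integral_mono_of_nonneg (ae_of_all _ fun _ => abs_nonneg _) (integrable_const _) (ae_of_all _ fun v => hFb (v, c))
    _ = CW * M * CΩ * P := by rw [integral_const, smul_eq_mul, hP]; ring

end Summit.QuantumFields.YangMills.Theorems.FemtoTransferGap.TwoLattice.ConstTube

end
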